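import Literature.NumberTheory.Automorphic.UnitaryGroupLocalIntegralMembership
import Literature.NumberTheory.Automorphic.QuadraticIdelicNormRange
import HarnessLib

/-!
# Integral root data of `U(J)(F_v)` at a good non-dyadic place for a diagonal form of constant valuation (δ2-A)

Topic `NumberTheory/Automorphic`; namespace `Literature.NumberTheory.Automorphic.UnitaryGroup`.  KERNEL ONLY: one theorem,
no definition, no named fact, no `sorry`.  Sequel of `UnitaryGroupLocalIntegralMembership` (integrality ⇒ `U(J)(𝒪_v)` for a
diagonal Gram matrix of constant valuation), `UnitaryGroupIsotropicRootSymplectic` (root elements `n_{bδ}(r) = localRootElt …`),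
`UnitaryGroupIsotropicLineElements` (dilations `D(α, β) = lineDilation …`) [Dieudonne1971GroupesClassiques, Chap. II §5] and
`QuadraticIdelicNormRange` (units are norms of integers at a non-dyadic place where `d` is a unit,
`exists_sq_sub_mul_sq_eq_of_valued_eq_one` [Omeara1963, §63B Example 63:12, §65A Example 65:1]).

Setting: `E/F` quadratic with conjugation `c`, `δ ∈ E` with `c δ = −δ ≠ 0`, `δ² = d ∈ F`; a finite place `v` of `F` with
`|2|_v = |d|_v = 1`; a DIAGONAL form `J = T ⊗ 1`, `T = diagonal tD`, ALL of whose entries have the same valuation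
`|tD i|_v = q_v^{-m}`; two indices `i₁ ≠ i₂`.

**`exists_integralRootData`** (the δ2-A letter of the cell's ROAD δ, F0P2-p01's spec `ROAD-DELTA-delta2A.SPEC`, statement
verbatim up to the names of the two unused binders `_hT`, `_hE`): with `a² − d b² = −tD i₁ / tD i₂` (`a, b ∈ 𝒪_v`) and
`α₀ = ι a + ι b·(δ ⊗ 1)` (so `σ(α₀) α₀ · ι(tD i₂) = −ι(tD i₁)`): the isotropic integral vector `r = e_{i₁} + α₀ e_{i₂}`, its partner
`r' = (2 tD i₁)⁻¹ (e_{i₁} − α₀ e_{i₂})` (`h(r', r') = 0`, `h(r, r') = 1`), both supported on `{i₁, i₂}`; the `K`-membership of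
`n_{bδ}(r)` for `b ∈ 𝔭^{−m}` (entries `δ_{ij} + r_i ι(b tD j) (δ ⊗ 1) σ(r_j)`, `|b tD j|_v ≤ 1`), of `n_{bδ}(r')` for `b ∈ 𝔭^{m}`
(entries with the scalar `ι(λ² b tD j)`, `λ = (2 tD i₁)⁻¹`, `|λ|_v = q_v^{m}`), of every unitary dilation `D(α, β)` with `α, β`
integral (scalar `ι(λ tD j)` of absolute value `1`) — all three through `localPiEquiv_symm_mem_localInt_of_isIntegralLoc` — and the
`w`-integral `α₁ = ι a' + ι b'·(δ ⊗ 1)` with `a'² − d b'² = −1`: `σ(α₁)(−α₁) = 1`, `α₁ σ(α₁) = ι(−1)`, `|−1 − 1|_v = |2|_v = 1`.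

Written for the cell hodgecm-mathlib (ROAD δ of the NSI closer; consumed by `UnitaryGroupOddLineNoIntegralEigenvector`).
HC_CM is proved only modulo the printed citations until rung 0 closes.

## References
* [Dieudonne1971GroupesClassiques] J. Dieudonné, *La géométrie des groupes classiques*, 3e éd. (1971), Chap. II §5.
* [PlatonovRapinchuk1994] V. Platonov, A. Rapinchuk, *Algebraic Groups and Number Theory* (1994), §5.1.
* [Omeara1963] O. T. O'Meara, *Introduction to Quadratic Forms* (1963), §63B Example 63:12, §65A Example 65:1.
-/

set_option autoImplicit false

noncomputable section

open NumberField IsDedekindDomain Matrix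
open scoped NNReal
open Literature.NumberTheory.Automorphic Literature.NumberTheory.Automorphic.UnitaryGroup
open Literature.NumberTheory.GaloisRepresentations.IsNonarchimedeanLocalField
open Literature.NumberTheory.GelbartRogawski1991.UnitaryDualPair.LocalSplitting

namespace Literature.NumberTheory.Automorphic.UnitaryGroup

/-! ## The integral root data (δ2-A) -/

section RootData

variable {F : Type} [Field F] [NumberField F] (E : Type) [Field E] [NumberField E] [Algebra F E]
  [Algebra.IsQuadraticExtension F E] (c : E ≃ₐ[F] E) (N : ℕ) (J : Matrix (Fin N) (Fin N) E)
  (v : HeightOneSpectrum (𝓞 F)) {δ : E} (hcδ : c δ = -δ) (hδ : δ ≠ 0) {d : F} (hd : δ * δ = algebraMap F E d)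

include hd in
/-- **δ2-A: integral root data at a good inert place for a diagonal form of constant valuation `m`.**  For `T = diagonal tD`
with `|tD i|_v = q_v^{-m}` for all `i`, `|2|_v = |d|_v = 1` and `i₁ ≠ i₂`: there are `r, r'` supported on `{i₁, i₂}` with
`h(r, r) = h(r', r') = 0`, `h(r, r') = 1`, such that the root elements `n_{bδ}(r)` (`b ∈ 𝔭^{-m}`) and `n_{bδ}(r')` (`b ∈ 𝔭^{m}`)
and every unitary dilation `D(α, β)` of the pair with `α, β` integral lie in `U(J)(𝒪_v)`, together with a `w`-integral `α` of norm
`n` with `|n − 1|_v = 1` (namely `n = −1`).  (`r = e_{i₁} + α₀ e_{i₂}` with `N(α₀) = −tD i₁ / tD i₂` a norm of an integer,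
`r' = (2 tD i₁)⁻¹ (e_{i₁} − α₀ e_{i₂})`; the hypothesis `IsField (E ⊗ F_v)` of the letter is not used.)
[cite: Dieudonne1971GroupesClassiques, Chap. II §5] [cite: PlatonovRapinchuk1994, §5.1] [cite: Omeara1963, §63B Example 63:12] -/
theorem exists_integralRootData (T : Matrix (Fin N) (Fin N) F) (_hT : T.IsSymm) (hJ : J = T.map (algebraMap F E))
    (hJh : (J.map c)ᵀ = J) (tD : Fin N → F) (hTD : T = Matrix.diagonal tD) (i₁ i₂ : Fin N) (hi : i₁ ≠ i₂)
    (_hE : IsField (LocalRing E v))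
    (h2 : normAbs (v.adicCompletion F) (2 : v.adicCompletion F) = 1)
    (hdv : normAbs (v.adicCompletion F) (algebraMap F (v.adicCompletion F) d) = 1)
    (m : ℤ) (hm : ∀ i, normAbs (v.adicCompletion F) (algebraMap F (v.adicCompletion F) (tD i)) =
      ((residueFieldCard (v.adicCompletion F) : ℝ≥0)⁻¹) ^ m) :
    ∃ (r r' : Fin N → LocalRing E v)
      (hr : hermForm (conjLocal E c v) ((adelicForm E N J).map (adeleToLocal E v)) r r = 0)
      (hr' : hermForm (conjLocal E c v) ((adelicForm E N J).map (adeleToLocal E v)) r' r' = 0),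
      hermForm (conjLocal E c v) ((adelicForm E N J).map (adeleToLocal E v)) r r' = 1 ∧
      (∀ k, k ≠ i₁ → k ≠ i₂ → r k = 0 ∧ r' k = 0) ∧
      -- root elements of `r` are integral for `b ∈ 𝔭^{-m}`
      (∀ b ∈ primePowBall (v.adicCompletion F) (-m),
        localRootElt E c N J v hcδ hδ hJh hr b ∈ localInt E c N J v) ∧
      -- root elements of `r'` are integral for `b ∈ 𝔭^{m}`
      (∀ b ∈ primePowBall (v.adicCompletion F) m,
        localRootElt E c N J v hcδ hδ hJh hr' b ∈ localInt E c N J v) ∧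
      -- the Levi dilations `D(α, β)`, `α` a `w`-unit, are integral
      (∀ (α β : LocalRing E v), IsIntegralLoc F E v α → IsIntegralLoc F E v β →
        ∀ g : «local» E c N J v, (g : GL (Fin N) (LocalRing E v)).val =
            lineDilation (conjLocal E c v) ((adelicForm E N J).map (adeleToLocal E v)) r r' α β →
          (localPiEquiv E c N J v).symm g ∈ localInt E c N J v) ∧
      -- a unit `α` of `𝒪_w` whose norm `n = α σ(α)` has `n - 1` a unit of `𝒪_v`
      (∃ (α β : LocalRing E v) (n : v.adicCompletion F), IsIntegralLoc F E v α ∧ IsIntegralLoc F E v β ∧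
        conjLocal E c v α * β = 1 ∧ α * conjLocal E c v α = toLocalRing E v n ∧
        normAbs (v.adicCompletion F) (n - 1) = 1) := by
  -- the scalars of the place
  set ι : v.adicCompletion F →+* LocalRing E v := toLocalRing E v with hι
  set σ : LocalRing E v →+* LocalRing E v := conjLocal E c v with hσ
  set δS : LocalRing E v := algebraMap E (LocalRing E v) δ with hδS
  set tK : Fin N → v.adicCompletion F := fun i => algebraMap F (v.adicCompletion F) (tD i) with htK
  set Q : ℝ≥0 := ((residueFieldCard (v.adicCompletion F) : ℝ≥0)⁻¹) with hQ
  have hJv : (adelicForm E N J).map (adeleToLocal E v) = Matrix.diagonal fun i => ι (tK i) :=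
    localGram_eq_diagonal E v hJ hTD
  have hQ0 : Q ≠ 0 := inv_residueFieldCard_pos.ne'
  have htKm : ∀ i, normAbs (v.adicCompletion F) (tK i) = Q ^ m := hm
  have htK0 : ∀ i, tK i ≠ 0 := fun i h0 => by
    have h1 := htKm i
    rw [h0, map_zero] at h1
    exact zpow_ne_zero m hQ0 h1.symm
  have htKv : ∀ i j, Valued.v (tK i) = Valued.v (tK j) := fun i j =>
    valued_eq_of_normAbs_eq v ((htKm i).trans (htKm j).symm)
  have h2K : (2 : v.adicCompletion F) ≠ 0 := fun h0 => by
    rw [h0, map_zero] at h2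
    exact zero_ne_one h2
  have h2v := two_not_mem_of_normAbs_two v h2
  have hdv1 : Valued.v (algebraMap F (v.adicCompletion F) d) = 1 := valued_eq_one_of_normAbs_eq_one v hdv
  -- integrality of the basic scalars
  have hδI : IsIntegralLoc F E v δS := isIntegralLoc_delta E v hd hdv
  have hιI : ∀ {x : v.adicCompletion F}, normAbs (v.adicCompletion F) x ≤ 1 → IsIntegralLoc F E v (ι x) :=
    fun hx => isIntegralLoc_toLocalRing_of_normAbs_le E v hx
  have hσδ : σ δS = -δS := by rw [hδS, hσ, conjLocal_algebraMap, hcδ, map_neg]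
  have hδδ : δS * δS = ι (algebraMap F (v.adicCompletion F) d) := by
    rw [hδS, ← map_mul, hd]
    exact (toLocalRing_coe E v d).symm
  -- the norm identity `σ(ι a + ι b δ) (ι a + ι b δ) = ι(a² − d b²)`
  have hnorm : ∀ a b : v.adicCompletion F,
      σ (ι a + ι b * δS) * (ι a + ι b * δS) = ι (a ^ 2 - algebraMap F (v.adicCompletion F) d * b ^ 2) := by
    intro a b
    rw [map_add, map_mul, hσ, conjLocal_toLocalRing, conjLocal_toLocalRing, ← hσ, hσδ]
    calc (ι a + ι b * -δS) * (ι a + ι b * δS) = ι a * ι a - ι b * ι b * (δS * δS) := by ring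
      _ = ι (a ^ 2 - algebraMap F (v.adicCompletion F) d * b ^ 2) := by
          rw [hδδ, map_sub, map_mul, map_pow, map_pow]; ring
  have hσι : ∀ a b : v.adicCompletion F, σ (ι a + ι b * δS) = ι a - ι b * δS := by
    intro a b
    rw [map_add, map_mul, hσ, conjLocal_toLocalRing, conjLocal_toLocalRing, ← hσ, hσδ, mul_neg, sub_eq_add_neg]
  -- the unit `u = −tD i₁ / tD i₂` is the norm of an integer `α₀`
  have hu : Valued.v (-(tK i₁ / tK i₂)) = 1 := by
    rw [Valuation.map_neg, map_div₀, htKv i₁ i₂, div_self ((Valuation.ne_zero_iff _).2 (htK0 i₂))]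
  obtain ⟨a, b, ha, hb, hab⟩ := exists_sq_sub_mul_sq_eq_of_valued_eq_one F v h2v hdv1 hu
  set α₀ : LocalRing E v := ι a + ι b * δS with hα₀
  have haI : IsIntegralLoc F E v (ι a) := (isIntegralLoc_toLocalRing_iff F E v a).2 ha
  have hbI : IsIntegralLoc F E v (ι b) := (isIntegralLoc_toLocalRing_iff F E v b).2 hb
  have hα₀I : IsIntegralLoc F E v α₀ := haI.add (hbI.mul hδI)
  have hσα₀I : IsIntegralLoc F E v (σ α₀) := hα₀I.conj c
  have hN : σ α₀ * α₀ = ι (-(tK i₁ / tK i₂)) := by rw [hα₀, hnorm, hab]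
  -- `σ(α₀) α₀ · ι(t₂) = −ι(t₁)`
  have hNt : σ α₀ * α₀ * ι (tK i₂) = -ι (tK i₁) := by
    rw [hN, ← map_mul, ← map_neg]
    congr 1
    rw [neg_mul, div_mul_cancel₀ _ (htK0 i₂)]
  -- `λ = (2 t₁)⁻¹`, `|λ|_v = q^{m}`
  set lam : v.adicCompletion F := (2 * tK i₁)⁻¹ with hlam
  have hlam_n : normAbs (v.adicCompletion F) lam = Q ^ (-m) := by
    rw [hlam, map_inv₀, map_mul, h2, one_mul, htKm, _root_.zpow_neg]
  have hlam_t : ∀ j, normAbs (v.adicCompletion F) (lam * tK j) = 1 := fun j => by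
    rw [map_mul, hlam_n, htKm, ← zpow_add₀ hQ0, neg_add_cancel, zpow_zero]
  have hlam2 : lam * (2 * tK i₁) = 1 := inv_mul_cancel₀ (mul_ne_zero h2K (htK0 i₁))
  -- the vectors
  set r : Fin N → LocalRing E v := fun k => if k = i₁ then 1 else if k = i₂ then α₀ else 0 with hr
  set r₀ : Fin N → LocalRing E v := fun k => if k = i₁ then 1 else if k = i₂ then -α₀ else 0 with hr₀
  set r' : Fin N → LocalRing E v := fun k => ι lam * r₀ k with hr'
  have hr1 : r i₁ = 1 := by simp [hr]
  have hr2 : r i₂ = α₀ := by simp [hr, hi.symm]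
  have hr00 : ∀ k, k ≠ i₁ → k ≠ i₂ → r k = 0 := fun k hk₁ hk₂ => by simp [hr, hk₁, hk₂]
  have hr₀1 : r₀ i₁ = 1 := by simp [hr₀]
  have hr₀2 : r₀ i₂ = -α₀ := by simp [hr₀, hi.symm]
  have hr₀0 : ∀ k, k ≠ i₁ → k ≠ i₂ → r₀ k = 0 := fun k hk₁ hk₂ => by simp [hr₀, hk₁, hk₂]
  have hr'1 : r' i₁ = ι lam := by simp only [hr', hr₀1, mul_one]
  have hr'2 : r' i₂ = -(ι lam * α₀) := by simp only [hr', hr₀2, mul_neg]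
  have hr'0 : ∀ k, k ≠ i₁ → k ≠ i₂ → r' k = 0 := fun k hk₁ hk₂ => by simp only [hr', hr₀0 k hk₁ hk₂, mul_zero]
  -- integrality of the entries of the vectors
  have hrI : ∀ k, IsIntegralLoc F E v (r k) := fun k => by
    by_cases hk₁ : k = i₁
    · rw [hk₁, hr1]; exact isIntegralLoc_one E v
    · by_cases hk₂ : k = i₂
      · rw [hk₂, hr2]; exact hα₀I
      · rw [hr00 k hk₁ hk₂]; exact IsIntegralLoc.zero
  have hr₀I : ∀ k, IsIntegralLoc F E v (r₀ k) := fun k => by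
    by_cases hk₁ : k = i₁
    · rw [hk₁, hr₀1]; exact isIntegralLoc_one E v
    · by_cases hk₂ : k = i₂
      · rw [hk₂, hr₀2]; exact hα₀I.neg
      · rw [hr₀0 k hk₁ hk₂]; exact IsIntegralLoc.zero
  have hσr' : ∀ k, σ (r' k) = ι lam * σ (r₀ k) := fun k => by
    rw [hr', map_mul, hσ, conjLocal_toLocalRing]
  -- the three pairing values
  have core : ι (tK i₁) + σ α₀ * (ι (tK i₂) * α₀) = 0 := by
    have e : σ α₀ * (ι (tK i₂) * α₀) = σ α₀ * α₀ * ι (tK i₂) := by ring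
    rw [e, hNt, add_neg_cancel]
  have hrr : hermForm (conjLocal E c v) ((adelicForm E N J).map (adeleToLocal E v)) r r = 0 := by
    rw [hJv, hermForm_diagonal_of_support_pair E v _ _ r r hi hr00, hr1, hr2, map_one, one_mul, mul_one]
    exact core
  have hr'r' : hermForm (conjLocal E c v) ((adelicForm E N J).map (adeleToLocal E v)) r' r' = 0 := by
    rw [hJv, hermForm_diagonal_of_support_pair E v _ _ r' r' hi hr'0, ← hσ, hσr', hσr', hr₀1, hr₀2, hr'1, hr'2, map_one,
      map_neg]
    have e : ι lam * 1 * (ι (tK i₁) * ι lam) + ι lam * -σ α₀ * (ι (tK i₂) * -(ι lam * α₀)) =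
        ι lam * ι lam * (ι (tK i₁) + σ α₀ * (ι (tK i₂) * α₀)) := by ring
    rw [e, core, mul_zero]
  have hrr' : hermForm (conjLocal E c v) ((adelicForm E N J).map (adeleToLocal E v)) r r' = 1 := by
    rw [hJv, hermForm_diagonal_of_support_pair E v _ _ r r' hi hr00, ← hσ, hr1, hr2, hr'1, hr'2, map_one, one_mul]
    have e : ι (tK i₁) * ι lam + σ α₀ * (ι (tK i₂) * -(ι lam * α₀)) =
        ι lam * (ι (tK i₁) - σ α₀ * α₀ * ι (tK i₂)) := by ring
    rw [e, hNt, sub_neg_eq_add, ← two_mul, ← map_ofNat ι 2, ← map_mul, ← map_mul, hlam2, map_one]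
  -- membership in `U(J)(𝒪_v)` from integrality of the matrix (§2)
  have hmem : ∀ g : «local» E c N J v, (∀ i j, IsIntegralLoc F E v ((g : GL (Fin N) (LocalRing E v)).val i j)) →
      (localPiEquiv E c N J v).symm g ∈ localInt E c N J v := fun g hg =>
    localPiEquiv_symm_mem_localInt_of_isIntegralLoc E c N J v htK0 htKv hJv g hg
  refine ⟨r, r', hrr, hr'r', hrr', fun k hk₁ hk₂ => ⟨hr00 k hk₁ hk₂, hr'0 k hk₁ hk₂⟩, ?_, ?_, ?_, ?_⟩
  · -- root elements of `r`, `b ∈ 𝔭^{-m}`: entries `δ_{ij} + r_i · ι(b) δ σ(r_j) ι(t_j)`, `|b t_j|_v ≤ 1`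
    intro b hb
    rw [mem_primePowBall_iff] at hb
    have hbt : ∀ j, IsIntegralLoc F E v (ι (b * tK j)) := fun j => hιI (by
      rw [map_mul, htKm]
      calc normAbs (v.adicCompletion F) b * Q ^ m ≤ Q ^ (-m) * Q ^ m := mul_le_mul' hb le_rfl
        _ = 1 := by rw [← zpow_add₀ hQ0, neg_add_cancel, zpow_zero])
    have h := hmem (localPiEquiv E c N J v (localRootElt E c N J v hcδ hδ hJh hrr b)) fun i j => by
      rw [coe_localPiEquiv_localRootElt, hJv, lineRoot_zero_diagonal_apply]
      refine (isIntegralLoc_one_apply E v i j).add ((hrI i).mul ?_)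
      have e : ι b * δS * (σ (r j) * ι (tK j)) = ι (b * tK j) * (δS * σ (r j)) := by rw [map_mul]; ring
      rw [e]
      exact (hbt j).mul (hδI.mul ((hrI j).conj c))
    rwa [ContinuousMulEquiv.symm_apply_apply] at h
  · -- root elements of `r'`, `b ∈ 𝔭^{m}`: entries `δ_{ij} + ι(λ² b t_j) · r₀_i δ σ(r₀_j)`, `|λ² b t_j|_v ≤ 1`
    intro b hb
    rw [mem_primePowBall_iff] at hb
    have hbt : ∀ j, IsIntegralLoc F E v (ι (lam * lam * b * tK j)) := fun j => hιI (by
      rw [map_mul, map_mul, map_mul, hlam_n, htKm]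
      calc Q ^ (-m) * Q ^ (-m) * normAbs (v.adicCompletion F) b * Q ^ m ≤ Q ^ (-m) * Q ^ (-m) * Q ^ m * Q ^ m :=
            mul_le_mul' (mul_le_mul' le_rfl hb) le_rfl
        _ = 1 := by
            rw [← zpow_add₀ hQ0, ← zpow_add₀ hQ0, ← zpow_add₀ hQ0, show -m + -m + m + m = 0 by ring, zpow_zero])
    have h := hmem (localPiEquiv E c N J v (localRootElt E c N J v hcδ hδ hJh hr'r' b)) fun i j => by
      rw [coe_localPiEquiv_localRootElt, hJv, lineRoot_zero_diagonal_apply, ← hσ, hσr', hr']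
      refine (isIntegralLoc_one_apply E v i j).add ?_
      have e : ι lam * r₀ i * (ι b * δS * (ι lam * σ (r₀ j) * ι (tK j))) =
          ι (lam * lam * b * tK j) * (r₀ i * (δS * σ (r₀ j))) := by rw [map_mul, map_mul, map_mul]; ring
      rw [e]
      exact (hbt j).mul ((hr₀I i).mul (hδI.mul ((hr₀I j).conj c)))
    rwa [ContinuousMulEquiv.symm_apply_apply] at h
  · -- dilations `D(α, β)` with `α, β` integral: entries `δ_{ij} + r_i (α−1) ι(λ t_j) σ(r₀_j) + ι(λ t_j) r₀_i (β−1) σ(r_j)`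
    intro α β hαI hβI g hg
    refine hmem g fun i j => ?_
    rw [hg, hJv, lineDilation_diagonal_apply, ← hσ, hσr', hr']
    refine ((isIntegralLoc_one_apply E v i j).add ?_).add ?_
    · have e : r i * ((α - 1) * (ι lam * σ (r₀ j) * ι (tK j))) = ι (lam * tK j) * (r i * ((α - 1) * σ (r₀ j))) := by
        rw [map_mul]; ring
      rw [e]
      exact (hιI (hlam_t j).le).mul ((hrI i).mul ((hαI.sub (isIntegralLoc_one E v)).mul ((hr₀I j).conj c)))
    · have e : ι lam * r₀ i * ((β - 1) * (σ (r j) * ι (tK j))) = ι (lam * tK j) * (r₀ i * ((β - 1) * σ (r j))) := by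
        rw [map_mul]; ring
      rw [e]
      exact (hιI (hlam_t j).le).mul ((hr₀I i).mul ((hβI.sub (isIntegralLoc_one E v)).mul ((hrI j).conj c)))
  · -- `α₁ = ι a' + ι b' δ` with `a'² − d b'² = −1`: `σ(α₁) α₁ = −1`, `β = −α₁`, `n = −1`, `|−1 − 1|_v = |2|_v = 1`
    have hm1 : Valued.v (-1 : v.adicCompletion F) = 1 := by rw [Valuation.map_neg, map_one]
    obtain ⟨a', b', ha', hb', hab'⟩ := exists_sq_sub_mul_sq_eq_of_valued_eq_one F v h2v hdv1 hm1
    have hα₁I : IsIntegralLoc F E v (ι a' + ι b' * δS) :=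
      ((isIntegralLoc_toLocalRing_iff F E v a').2 ha').add (((isIntegralLoc_toLocalRing_iff F E v b').2 hb').mul hδI)
    have hN₁ : σ (ι a' + ι b' * δS) * (ι a' + ι b' * δS) = -1 := by rw [hnorm, hab', map_neg, map_one]
    refine ⟨ι a' + ι b' * δS, -(ι a' + ι b' * δS), -1, hα₁I, hα₁I.neg, ?_, ?_, ?_⟩
    · rw [mul_neg, hN₁, neg_neg]
    · rw [mul_comm, hN₁, map_neg, map_one]
    · rw [show (-1 - 1 : v.adicCompletion F) = -2 by norm_num, normAbs_neg, h2]

end RootData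

end Literature.NumberTheory.Automorphic.UnitaryGroup

end
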